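import Mathlib
import HarnessLib
import Literature.Analysis.FluidPDE.LocalLerayPressureBoundTools

/-!
# Covering count for uniformly local bounds (crux `stmt-NavierStokesRegularity-14060`,
  line `uloc-gronwall-transplant`, stub COV `stub_fplCovering`)

Crux `Summit.NavierStokesRegularity.NavierStokesRegularity.Theses.SymmetryModuliCount.FarPastLedger`,
line `uloc-gronwall-transplant`, stub `stub_fplCovering`: the pure measure-theoretic covering
count used by the flux ledger. If `g ≥ 0` is continuous on `ℝ³` with `∫_{B_1(z)} g ≤ B` for
every centre `z`, then for every `ρ ≥ 1` and every centre `x₁`,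
`∫_{B_ρ(x₁)} g ≤ 125 ρ³ B`.

Proof: the tree lemma `Literature.Analysis.FluidPDE.setLIntegral_ball_le_of_forall_unitBall`
gives `∫⁻_{B_ρ(x₁)} g ≤ |B_1|⁻¹ · B · |B_{ρ+1}| = (ρ+1)³ B` (Lebesgue scaling of balls in
dimension `3`), and `(ρ+1)³ ≤ (5ρ)³ = 125 ρ³` for `ρ ≥ 1`; the Bochner integrals are converted
to lower Lebesgue integrals using continuity (local integrability) and nonnegativity of `g`.
-/

noncomputable section

open MeasureTheory Metric Set
open scoped ENNReal

set_option linter.dupNamespace false -- nested layout Summit.<S>.<Sub>, Sub = S (D-0017)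

namespace Summit.NavierStokesRegularity.NavierStokesRegularity.Theorems

/-- A continuous real function on `ℝ³` is integrable on every open ball (balls are relatively
compact in the proper space `ℝ³`). -/
theorem fpl_covering_integrableOn_ball {g : EuclideanSpace ℝ (Fin 3) → ℝ} (hg : Continuous g)
    (z : EuclideanSpace ℝ (Fin 3)) (r : ℝ) : IntegrableOn g (ball z r) volume :=
  ((hg.continuousOn (s := closedBall z r)).integrableOn_compact
    (isCompact_closedBall z r)).mono_set ball_subset_closedBall

/-- For a continuous nonnegative real function on `ℝ³`, the Bochner integral over a ball, cast to
`ℝ≥0∞`, is the lower Lebesgue integral of `ENNReal.ofReal ∘ g` over that ball. -/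
theorem fpl_covering_ofReal_setIntegral_ball {g : EuclideanSpace ℝ (Fin 3) → ℝ}
    (hg : Continuous g) (hg0 : ∀ x, 0 ≤ g x) (z : EuclideanSpace ℝ (Fin 3)) (r : ℝ) :
    ENNReal.ofReal (∫ x in ball z r, g x) = ∫⁻ x in ball z r, ENNReal.ofReal (g x) :=
  ofReal_integral_eq_lintegral_ofReal (fpl_covering_integrableOn_ball hg z r)
    (ae_of_all _ fun x => hg0 x)

/-- Lebesgue scaling of balls in `ℝ³`: `|B_1|⁻¹ · (A · |B_r|) = A · r³` for `0 ≤ r`. -/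
theorem fpl_covering_volume_ratio (A : ℝ≥0∞) {r : ℝ} (hr : 0 ≤ r) :
    (volume (ball (0 : EuclideanSpace ℝ (Fin 3)) 1))⁻¹ *
      (A * volume (ball (0 : EuclideanSpace ℝ (Fin 3)) r)) = A * ENNReal.ofReal (r ^ 3) := by
  have h0 : volume (ball (0 : EuclideanSpace ℝ (Fin 3)) 1) ≠ 0 :=
    (measure_ball_pos volume (0 : EuclideanSpace ℝ (Fin 3)) one_pos).ne'
  have htop : volume (ball (0 : EuclideanSpace ℝ (Fin 3)) 1) ≠ ⊤ := measure_ball_lt_top.ne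
  have hscale : volume (ball (0 : EuclideanSpace ℝ (Fin 3)) r) =
      ENNReal.ofReal (r ^ 3) * volume (ball (0 : EuclideanSpace ℝ (Fin 3)) 1) := by
    rw [Measure.addHaar_ball volume (0 : EuclideanSpace ℝ (Fin 3)) hr, finrank_euclideanSpace,
      Fintype.card_fin]
  rw [hscale]
  calc (volume (ball (0 : EuclideanSpace ℝ (Fin 3)) 1))⁻¹ *
        (A * (ENNReal.ofReal (r ^ 3) * volume (ball (0 : EuclideanSpace ℝ (Fin 3)) 1)))
        = A * ENNReal.ofReal (r ^ 3) * ((volume (ball (0 : EuclideanSpace ℝ (Fin 3)) 1))⁻¹ *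
            volume (ball (0 : EuclideanSpace ℝ (Fin 3)) 1)) := by ring
    _ = A * ENNReal.ofReal (r ^ 3) := by rw [ENNReal.inv_mul_cancel h0 htop, mul_one]

/-- **Covering count** (stub COV of line `uloc-gronwall-transplant`). If `g ≥ 0` is continuous
on `ℝ³` and `∫_{B_1(z)} g ≤ B` for every centre `z`, then `∫_{B_ρ(x₁)} g ≤ 125 ρ³ B` for every
`ρ ≥ 1` and every centre `x₁`: average the unit-ball bound over the centres of `B_{ρ+1}(x₁)`
(tree lemma `setLIntegral_ball_le_of_forall_unitBall`), `|B_{ρ+1}| / |B_1| = (ρ+1)³ ≤ 125 ρ³`. -/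
theorem stub_fplCovering :
    ∀ (ρ : ℝ), 1 ≤ ρ → ∀ (g : EuclideanSpace ℝ (Fin 3) → ℝ), Continuous g → (∀ x, 0 ≤ g x) →
    ∀ (B : ℝ) (x₁ : EuclideanSpace ℝ (Fin 3)),
    (∀ z : EuclideanSpace ℝ (Fin 3), ∫ x in Metric.ball z 1, g x ≤ B) →
    ∫ x in Metric.ball x₁ ρ, g x ≤ 125 * ρ ^ 3 * B := by
  intro ρ hρ g hg hg0 B x₁ hB
  -- `B ≥ 0` since `g ≥ 0`
  have hBnn : 0 ≤ B := le_trans (setIntegral_nonneg measurableSet_ball fun x _ => hg0 x) (hB x₁)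
  have hρ1 : 0 ≤ ρ + 1 := by linarith
  -- the unit-ball hypothesis in `ℝ≥0∞` form
  have hA : ∀ z : EuclideanSpace ℝ (Fin 3),
      ∫⁻ y in ball z 1, ENNReal.ofReal (g y) ≤ ENNReal.ofReal B := fun z => by
    rw [← fpl_covering_ofReal_setIntegral_ball hg hg0 z 1]
    exact ENNReal.ofReal_le_ofReal (hB z)
  -- the tree covering lemma
  have key := Literature.Analysis.FluidPDE.setLIntegral_ball_le_of_forall_unitBall
    (g := fun x => ENNReal.ofReal (g x)) (hg.measurable.ennreal_ofReal.aemeasurable) hA x₁ ρ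
  rw [← fpl_covering_ofReal_setIntegral_ball hg hg0 x₁ ρ,
    fpl_covering_volume_ratio (ENNReal.ofReal B) hρ1, ← ENNReal.ofReal_mul hBnn,
    ENNReal.ofReal_le_ofReal_iff (mul_nonneg hBnn (pow_nonneg hρ1 3))] at key
  -- `(ρ+1)³ ≤ (5ρ)³ = 125 ρ³`
  have hpow : (ρ + 1) ^ 3 ≤ 125 * ρ ^ 3 := by
    calc (ρ + 1) ^ 3 ≤ (5 * ρ) ^ 3 := pow_le_pow_left₀ hρ1 (by linarith) 3
      _ = 125 * ρ ^ 3 := by ring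
  calc ∫ x in ball x₁ ρ, g x ≤ B * (ρ + 1) ^ 3 := key
    _ ≤ B * (125 * ρ ^ 3) := mul_le_mul_of_nonneg_left hpow hBnn
    _ = 125 * ρ ^ 3 * B := by ring

end Summit.NavierStokesRegularity.NavierStokesRegularity.Theorems

end
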